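import Summits.ResolutionOfSingularities.ResolutionOfSingularities.Theorems.FrobeniusClosingSteerInsepStepMaximalIdeal
import Mathlib.Algebra.CharP.Subring
import Mathlib.Algebra.CharP.Two
import HarnessLib

/-!
# Steer / LEMMA I kernel, file F2c: THE MAXIMAL IDEAL OF THE NEW MEMBER AT A DEGREE-FOUR INSEPARABLE NEAR POINT — `𝔪₁ = (X, t² − ℓ₁, z'² − ℓ₂)` and the
# 2-independence clause (LI₂)

OURS (campaign res-hironaka, rung L ★L-G4, slot W4.1, crux `Steer` stmt-ResolutionOfSingularities-16345; res-L0-w41-plan-1 RULING 155a, kernel of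
res-L0-w41-idea-3's LEMMA I `InsepStepNotIsolated`, degree-FOUR near point `(1 : μ₁ : μ₂)` (res-L0-w41-tri-1 v6.17); res-L0-w41-stub-3 g7, blueprint
`KERNEL-BLUEPRINT-LemmaI.md` 693d33707585fe97 §1 Case C; replaces the role of no printed item; NOT a statement of the manuscript under review
[claim: Hironaka2017, status: under-review]; AI review is weaker than expert review). Theses-free, definition-free.

Setting (Case C): quadratic transform `S₀ ≤ S₁` of local subrings of `L` (characteristic `2`), chart `X`, `𝔪₀ = (X, Y, Z)`, `t = Y/X`, `z' = Z/X`, and the near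
point has `t̄ ∉ κ₀` and `z̄' ∉ κ₀ + κ₀ t̄` (`∀ c e, z' − c − e t ∉ 𝔪₁`), with `t² − ℓ₁, z'² − ℓ₂ ∈ 𝔪₁` (exponent one).
* `mem_of_bilinear_mem` — **(LI₂)**: `a₀ + a₁ z' + (b₀ + b₁ z') t ∈ 𝔪₁ ⇒ a₀, a₁, b₀, b₁ ∈ 𝔪₀` (`{1, t̄, z̄', t̄ z̄'}` is `κ₀`-free; the inverse of `a + b t̄` is
  `(a + b t̄)/(a² + b² ℓ̄₁)` in characteristic `2`);
* `eval_mem_span_of_eval_mem_maximalIdeal_four` — Euclid by `Z'² − ℓ₂` then by `T² − ℓ₁`: `G(t, z') ∈ 𝔪₁ ⇒ G(t, z') ∈ (X, t² − ℓ₁, z'² − ℓ₂)`;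
* `maximalIdeal_eq_span_triple_four` — **`𝔪₁ = (X, t² − ℓ₁, z'² − ℓ₂) S₁`**.
[cite: Cutkosky2014, §2.1] [cite: Matsumura1987, Thm. 14.2] [folklore]
-/

noncomputable section

-- single-problem summit: the doubled namespace component `ResolutionOfSingularities` is forced
set_option linter.dupNamespace false

namespace Summit.ResolutionOfSingularities.ResolutionOfSingularities.Theorems.SwitchingDichotomy.LemmaI

open IsLocalRing Polynomial Literature.AlgebraicGeometry.Resolution

variable {L : Type} [Field L] {S₀ S₁ : Subring L} [IsLocalRing S₀] [IsLocalRing S₁]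

/-- **(LI₂)** at a degree-four near point. [folklore] -/
theorem mem_of_bilinear_mem [CharP L 2] (hdom : SubringDominates S₀ S₁) (t₁ z₁ : S₁)
    (ht : ∀ a : S₀, t₁ - Subring.inclusion hdom.1 a ∉ maximalIdeal S₁)
    (hz : ∀ c e : S₀, z₁ - Subring.inclusion hdom.1 c - Subring.inclusion hdom.1 e * t₁ ∉ maximalIdeal S₁)
    (ℓ₁ : S₀) (hq₁ : t₁ ^ 2 - Subring.inclusion hdom.1 ℓ₁ ∈ maximalIdeal S₁) (a₀ a₁ b₀ b₁ : S₀)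
    (hmem : Subring.inclusion hdom.1 a₀ + Subring.inclusion hdom.1 a₁ * z₁ +
      (Subring.inclusion hdom.1 b₀ + Subring.inclusion hdom.1 b₁ * z₁) * t₁ ∈ maximalIdeal S₁) :
    a₀ ∈ maximalIdeal S₀ ∧ a₁ ∈ maximalIdeal S₀ ∧ b₀ ∈ maximalIdeal S₀ ∧ b₁ ∈ maximalIdeal S₀ := by
  set ι := Subring.inclusion hdom.1 with hι
  set A : S₁ := ι a₀ + ι b₀ * t₁ with hA
  set B : S₁ := ι a₁ + ι b₁ * t₁ with hB
  have hexpr : ι a₀ + ι a₁ * z₁ + (ι b₀ + ι b₁ * z₁) * t₁ = A + B * z₁ := by rw [hA, hB]; ring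
  rw [hexpr] at hmem
  have h2 : (2 : S₁) = 0 := CharTwo.two_eq_zero
  -- `B ∈ 𝔪₁`: otherwise `z̄'` would be rational over `κ₀(t̄)`
  have hBm : B ∈ maximalIdeal S₁ := by
    by_contra hBu
    set n : S₀ := a₁ ^ 2 + b₁ ^ 2 * ℓ₁ with hn
    have hBB : B * B = ι n + ι (b₁ ^ 2) * (t₁ ^ 2 - ι ℓ₁) := by
      rw [hB, hn, map_add, map_mul, map_pow, map_pow]
      linear_combination (ι a₁ * ι b₁ * t₁) * h2
    have hnu : ι n ∉ maximalIdeal S₁ := by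
      intro hnm
      apply hBu
      have hBB' : B * B ∈ maximalIdeal S₁ := by
        rw [hBB]; exact Ideal.add_mem _ hnm (Ideal.mul_mem_left _ _ hq₁)
      exact ((maximalIdeal.isMaximal S₁).isPrime.mem_or_mem hBB').elim id id
    have hn0 : n ∉ maximalIdeal S₀ := fun h => hnu ((inclusion_mem_maximalIdeal_iff hdom n).mpr h)
    have hnunit : IsUnit n := by
      by_contra h; exact hn0 ((mem_maximalIdeal _).mpr h)
    obtain ⟨n', hn'⟩ := hnunit.exists_left_inv
    -- `z₁ + A B n' ∈ 𝔪₁`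
    have hkey : z₁ + A * B * ι n' ∈ maximalIdeal S₁ := by
      have h1 : B * ι n' * (A + B * z₁) ∈ maximalIdeal S₁ := Ideal.mul_mem_left _ _ hmem
      have h2' : B * ι n' * (A + B * z₁) = (z₁ + A * B * ι n') + ι (b₁ ^ 2 * n') * (t₁ ^ 2 - ι ℓ₁) * z₁ := by
        have : B * ι n' * (A + B * z₁) = A * B * ι n' + (B * B) * ι n' * z₁ := by ring
        rw [this, hBB, map_mul]
        have hnn : ι n * ι n' = 1 := by rw [← map_mul, mul_comm, hn', map_one]
        linear_combination (z₁) * hnn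
      rw [h2'] at h1
      have h3 : ι (b₁ ^ 2 * n') * (t₁ ^ 2 - ι ℓ₁) * z₁ ∈ maximalIdeal S₁ :=
        Ideal.mul_mem_right _ _ (Ideal.mul_mem_left _ _ hq₁)
      have := Ideal.sub_mem _ h1 h3
      rwa [add_sub_cancel_right] at this
    -- contradiction with the irrationality of `z̄'` over `κ₀(t̄)`
    apply hz (-(a₀ * a₁ * n' + b₀ * b₁ * n' * ℓ₁)) (-((a₀ * b₁ + b₀ * a₁) * n'))
    have : z₁ - ι (-(a₀ * a₁ * n' + b₀ * b₁ * n' * ℓ₁)) - ι (-((a₀ * b₁ + b₀ * a₁) * n')) * t₁ =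
        (z₁ + A * B * ι n') - ι (b₀ * b₁ * n') * (t₁ ^ 2 - ι ℓ₁) := by
      rw [hA, hB]
      simp only [map_neg, map_add, map_mul]
      ring
    rw [this]
    exact Ideal.sub_mem _ hkey (Ideal.mul_mem_left _ _ hq₁)
  obtain ⟨ha₁, hb₁⟩ := mem_and_mem_of_add_mul_mem hdom t₁ ht a₁ b₁ hBm
  have hAm : A ∈ maximalIdeal S₁ := by
    have : A = (A + B * z₁) - B * z₁ := by ring
    rw [this]
    exact Ideal.sub_mem _ hmem (Ideal.mul_mem_right _ _ hBm)
  obtain ⟨ha₀, hb₀⟩ := mem_and_mem_of_add_mul_mem hdom t₁ ht a₀ b₀ hAm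
  exact ⟨ha₀, ha₁, hb₀, hb₁⟩

/-- **Euclid at a degree-four near point**: `G(t, z') ∈ 𝔪₁ ⇒ G(t, z') ∈ (X, t² − ℓ₁, z'² − ℓ₂)`. [folklore] -/
theorem eval_mem_span_of_eval_mem_maximalIdeal_four [CharP L 2] (hdom : SubringDominates S₀ S₁) {X : S₀}
    (hB : blowupRing S₀ (X : L) ≤ S₁) (hX0 : (X : L) ≠ 0) (t₁ z₁ : S₁)
    (ht : ∀ a : S₀, t₁ - Subring.inclusion hdom.1 a ∉ maximalIdeal S₁)
    (hz : ∀ c e : S₀, z₁ - Subring.inclusion hdom.1 c - Subring.inclusion hdom.1 e * t₁ ∉ maximalIdeal S₁)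
    (ℓ₁ ℓ₂ : S₀) (hq₁ : t₁ ^ 2 - Subring.inclusion hdom.1 ℓ₁ ∈ maximalIdeal S₁)
    (hq₂ : z₁ ^ 2 - Subring.inclusion hdom.1 ℓ₂ ∈ maximalIdeal S₁)
    (G : S₀[X][X]) (hG : eval₂RingHom (eval₂RingHom (Subring.inclusion hdom.1) t₁) z₁ G ∈ maximalIdeal S₁) :
    eval₂RingHom (eval₂RingHom (Subring.inclusion hdom.1) t₁) z₁ G ∈
      Ideal.span {Subring.inclusion hdom.1 X, t₁ ^ 2 - Subring.inclusion hdom.1 ℓ₁, z₁ ^ 2 - Subring.inclusion hdom.1 ℓ₂} := by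
  set ι := Subring.inclusion hdom.1 with hι
  set ψ : S₀[X] →+* S₁ := eval₂RingHom ι t₁ with hψ
  set φ : S₀[X][X] →+* S₁ := eval₂RingHom ψ z₁ with hφ
  set J : Ideal S₁ := Ideal.span {ι X, t₁ ^ 2 - ι ℓ₁, z₁ ^ 2 - ι ℓ₂} with hJ
  have hXJ : ι X ∈ J := Ideal.subset_span (by simp)
  have hq₁J : t₁ ^ 2 - ι ℓ₁ ∈ J := Ideal.subset_span (by simp)
  have hq₂J : z₁ ^ 2 - ι ℓ₂ ∈ J := Ideal.subset_span (by simp)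
  have hXspan : Ideal.span {ι X} ≤ J := by rw [Ideal.span_le, Set.singleton_subset_iff]; exact hXJ
  have hι0 : ∀ {r : S₀}, r ∈ maximalIdeal S₀ → ι r ∈ J := fun hr => hXspan (inclusion_mem_span_exc hdom.1 hB hX0 hr)
  -- Euclid in the outer variable `Z'` by `W₂ = Z'² − ℓ₂`
  set W₂ : S₀[X][X] := Polynomial.X ^ 2 - C (C ℓ₂) with hW₂
  have hW₂m : W₂.Monic := monic_X_pow_sub_C _ two_ne_zero
  have hW₂deg : W₂.degree = 2 := by rw [hW₂, degree_X_pow_sub_C (by norm_num)]; rfl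
  have hdiv₂ : G %ₘ W₂ + W₂ * (G /ₘ W₂) = G := modByMonic_add_div G W₂
  have hBdeg : (G %ₘ W₂).degree < 2 := by simpa [hW₂deg] using degree_modByMonic_lt G hW₂m
  have hBeq := eq_C_add_C_mul_X_of_degree_lt_two hBdeg
  set B₀ : S₀[X] := (G %ₘ W₂).coeff 0
  set B₁ : S₀[X] := (G %ₘ W₂).coeff 1
  have hW₂ev : φ W₂ = z₁ ^ 2 - ι ℓ₂ := by simp [hφ, hψ, hW₂]
  have hGev : φ G = ψ B₀ + ψ B₁ * z₁ + (z₁ ^ 2 - ι ℓ₂) * φ (G /ₘ W₂) := by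
    conv_lhs => rw [← hdiv₂, hBeq]
    rw [map_add, map_mul, hW₂ev, map_add, map_mul]
    simp only [hφ, coe_eval₂RingHom, eval₂_C, eval₂_X]
  -- Euclid in `T` by `W₁ = T² − ℓ₁`
  set W₁ : S₀[X] := Polynomial.X ^ 2 - C ℓ₁ with hW₁
  have hW₁m : W₁.Monic := monic_X_pow_sub_C _ two_ne_zero
  have hW₁deg : W₁.degree = 2 := by rw [hW₁, degree_X_pow_sub_C (by norm_num)]; rfl
  have hW₁ev : ψ W₁ = t₁ ^ 2 - ι ℓ₁ := by simp [hψ, hW₁]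
  have heuc : ∀ P : S₀[X], ψ P = ι ((P %ₘ W₁).coeff 0) + ι ((P %ₘ W₁).coeff 1) * t₁ + (t₁ ^ 2 - ι ℓ₁) * ψ (P /ₘ W₁) := by
    intro P
    have hd : P %ₘ W₁ + W₁ * (P /ₘ W₁) = P := modByMonic_add_div P W₁
    have hr := eq_C_add_C_mul_X_of_degree_lt_two (by simpa [hW₁deg] using degree_modByMonic_lt P hW₁m)
    conv_lhs => rw [← hd, hr]
    rw [map_add, map_mul, hW₁ev, map_add, map_mul]
    simp only [hψ, coe_eval₂RingHom, eval₂_C, eval₂_X]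
  set r₀₀ := (B₀ %ₘ W₁).coeff 0
  set r₀₁ := (B₀ %ₘ W₁).coeff 1
  set r₁₀ := (B₁ %ₘ W₁).coeff 0
  set r₁₁ := (B₁ %ₘ W₁).coeff 1
  -- the bilinear remainder lies in `𝔪₁`
  have hLmem : ι r₀₀ + ι r₁₀ * z₁ + (ι r₀₁ + ι r₁₁ * z₁) * t₁ ∈ maximalIdeal S₁ := by
    have hq₁m := hq₁
    have hq₂m := hq₂
    have : ι r₀₀ + ι r₁₀ * z₁ + (ι r₀₁ + ι r₁₁ * z₁) * t₁ =
        φ G - ((t₁ ^ 2 - ι ℓ₁) * ψ (B₀ /ₘ W₁) + (t₁ ^ 2 - ι ℓ₁) * ψ (B₁ /ₘ W₁) * z₁ +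
          (z₁ ^ 2 - ι ℓ₂) * φ (G /ₘ W₂)) := by
      rw [hGev, heuc B₀, heuc B₁]; ring
    rw [this]
    exact Ideal.sub_mem _ hG (Ideal.add_mem _ (Ideal.add_mem _ (Ideal.mul_mem_right _ _ hq₁m)
      (Ideal.mul_mem_right _ _ (Ideal.mul_mem_right _ _ hq₁m))) (Ideal.mul_mem_right _ _ hq₂m))
  obtain ⟨h₀₀, h₁₀, h₀₁, h₁₁⟩ := mem_of_bilinear_mem hdom t₁ z₁ ht hz ℓ₁ hq₁ r₀₀ r₁₀ r₀₁ r₁₁ hLmem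
  rw [show eval₂RingHom (eval₂RingHom (Subring.inclusion hdom.1) t₁) z₁ G = φ G from rfl, hGev, heuc B₀, heuc B₁]
  refine Ideal.add_mem _ (Ideal.add_mem _ ?_ ?_) (Ideal.mul_mem_right _ _ hq₂J)
  · exact Ideal.add_mem _ (Ideal.add_mem _ (hι0 h₀₀) (Ideal.mul_mem_right _ _ (hι0 h₀₁))) (Ideal.mul_mem_right _ _ hq₁J)
  · refine Ideal.mul_mem_right _ _ ?_
    exact Ideal.add_mem _ (Ideal.add_mem _ (hι0 h₁₀) (Ideal.mul_mem_right _ _ (hι0 h₁₁))) (Ideal.mul_mem_right _ _ hq₁J)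

/-- **`𝔪₁ = (X, t² − ℓ₁, z'² − ℓ₂) S₁`** at a degree-four inseparable near point. [folklore] -/
theorem maximalIdeal_eq_span_triple_four [CharP L 2] (hQT : IsQuadraticTransform S₀ S₁) (hdom : SubringDominates S₀ S₁) {X Y Z : S₀}
    (hXYZ : Ideal.span {X, Y, Z} = maximalIdeal S₀) (hX0 : (X : L) ≠ 0) (hB : blowupRing S₀ (X : L) ≤ S₁)
    (hfrac : ∀ w ∈ S₁, ∃ a ∈ blowupRing S₀ (X : L), ∃ b ∈ blowupRing S₀ (X : L), b⁻¹ ∈ S₁ ∧ w = a / b)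
    (t₁ z₁ : S₁) (ht₁ : (t₁ : L) = Y / X) (hz₁ : (z₁ : L) = Z / X)
    (ht : ∀ a : S₀, t₁ - Subring.inclusion hdom.1 a ∉ maximalIdeal S₁)
    (hz : ∀ c e : S₀, z₁ - Subring.inclusion hdom.1 c - Subring.inclusion hdom.1 e * t₁ ∉ maximalIdeal S₁)
    (ℓ₁ ℓ₂ : S₀) (hq₁ : t₁ ^ 2 - Subring.inclusion hdom.1 ℓ₁ ∈ maximalIdeal S₁)
    (hq₂ : z₁ ^ 2 - Subring.inclusion hdom.1 ℓ₂ ∈ maximalIdeal S₁) :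
    maximalIdeal S₁ = Ideal.span {Subring.inclusion hdom.1 X, t₁ ^ 2 - Subring.inclusion hdom.1 ℓ₁, z₁ ^ 2 - Subring.inclusion hdom.1 ℓ₂} := by
  have _ := hQT
  set ι := Subring.inclusion hdom.1 with hι
  apply le_antisymm
  · intro m hm
    obtain ⟨a, ha, b, hb, hbinv, hab⟩ := hfrac m m.2
    by_cases hb0 : b = 0
    · have : m = 0 := Subtype.ext (by rw [hab, hb0, div_zero]; rfl)
      rw [this]
      exact zero_mem _
    obtain ⟨G, hG⟩ := exists_polynomial_eval_eq hdom.1 hXYZ hX0 t₁ z₁ ht₁ hz₁ ha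
    set a₁ : S₁ := eval₂RingHom (eval₂RingHom ι t₁) z₁ G with ha₁
    have hma : a₁ = m * ⟨b, hB hb⟩ := Subtype.ext (by
      rw [Subring.coe_mul, hG, hab]; exact (div_mul_cancel₀ a hb0).symm)
    have ha₁m : a₁ ∈ maximalIdeal S₁ := by rw [hma]; exact Ideal.mul_mem_right _ _ hm
    have ha₁J := eval_mem_span_of_eval_mem_maximalIdeal_four hdom hB hX0 t₁ z₁ ht hz ℓ₁ ℓ₂ hq₁ hq₂ G ha₁m
    have hm' : m = a₁ * ⟨b⁻¹, hbinv⟩ := Subtype.ext (by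
      rw [Subring.coe_mul, hma, Subring.coe_mul]
      change (m : L) = (m : L) * b * b⁻¹
      rw [mul_assoc, mul_inv_cancel₀ hb0, mul_one])
    rw [hm']
    exact Ideal.mul_mem_right _ _ ha₁J
  · rw [Ideal.span_le]
    rintro w hw
    simp only [Set.mem_insert_iff, Set.mem_singleton_iff] at hw
    rcases hw with rfl | rfl | rfl
    · exact (inclusion_mem_maximalIdeal_iff hdom X).mpr (mem_of_span_triple_eq hXYZ).1
    · exact hq₁
    · exact hq₂

end Summit.ResolutionOfSingularities.ResolutionOfSingularities.Theorems.SwitchingDichotomy.LemmaI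

end
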